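import Summits.BirchSwinnertonDyer.BirchSwinnertonDyer.Theorems.ByReductionTypeAtTwoMultTowerNS2TwoAdicUnits
import Literature.NumberTheory.EllipticCurves.PAdicHeightsLogProofs
import HarnessLib

/-!
# Route `ByReductionTypeAtTwo`, crux `MultUpperHalfAtTwo` (item stmt-BirchSwinnertonDyer-19922), TOWER road, the
# SPLIT rows: KERNEL BRICK S1 — the DEPTH of a `2`-adic unit: `‖1 − u²‖ = 2^{−(s+1)}` forces
# `u^{2^j a} ≢ ±1 (mod 2^{s+j+1})` (`a` odd), and `ord₂ log₂(2^k u) = s` (Iwasawa logarithm)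

HONEST FRAMING (cell `bsd-2adic`, run/shared/lean/pub/bsd-2adic/, seat `bsd-2adic-mult` GEN 13, HUMAN RULINGS
D-0036 / D-0054 / D-0074): TOOL theorems only (no definition, no named fact, no `sorry`); closes nothing by itself;
nothing booked; BSD is not proved by any of this. First brick of the KERNEL proof of the projection of the PRINT
named fact `Greenberg1999.sec3_natCard_localTowerKerPrimary_splitMultiplicative_rat` (Greenberg, LNM 1716, §3,
pp. 92–93: `|ker(r_{v_n})| ∼ log_p(N q_E)/2p[F_v ∩ ℚ_p^cyc : ℚ_p]`) that the split TOWER doors of item 19922 consume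
(`MultTowerCert.atTwo_le_pow_of_split`: `#𝒦_{v,n}[2] ≤ 2^{k}` for `ord₂(log₂ q_E) ≤ k + 2`). This file is the
`2`-adic arithmetic, a DEPTH-`s` generalisation of tower-1's BRICK 12
(`MultTowerNS2.toZModPow_pow_ne_one_and_ne_neg_one_of_tateUnit`, the case `s = 2`, `u ≡ ±3 (mod 8)`):

* `norm_pow_sub_one_of_odd` — `‖z^a − 1‖ = ‖z − 1‖` for `a` odd, `‖z − 1‖ < 1` (in `ℤ₂`);
* `norm_pow_two_pow_sub_one` — `‖y^{2^j} − 1‖ = ‖y − 1‖ · ‖2‖^j` for `‖y − 1‖ < ‖2‖`;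
* `toZModPow_pow_ne_one_and_ne_neg_one_of_depth` — **`u^{2^j a} ≢ ±1 (mod 2^{s+j+1})`** for `‖u² − 1‖ = 2^{−(s+1)}`,
  `s ≥ 1`, `a` odd (if `u^e ≡ ±1 (mod 2^{s+j+1})` then `‖u^{2e} − 1‖ < 2^{−(s+j+1)} = ‖(u²)^{2^j a} − 1‖`);
* `norm_units_sq_sub_one_le` — `‖u² − 1‖ ≤ 2^{−3}` for a unit `u` of `ℤ₂`;
* `norm_padicLog_units_eq` — **`‖log₂ u‖ = 2 · ‖u² − 1‖`** for a unit `u` (the tree's log isometry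
  `norm_padicLogSeries_eq` at `y = u²`, `‖1 − u²‖ ≤ 1/8 < ‖2‖`, and `log u² = 2 log u`, `padicLog_mul_holds`);
* `padicLog_two_pow_mul` — `log₂(2^k x) = log₂ x` (Iwasawa's normalisation `log₂ 2 = 0`, `padicLog_natCast_self_holds`);
* `exists_depth_of_padicLog` — for `q = 2^k u`, `log₂ q ≠ 0`, `ord₂(log₂ q) ≤ K + 2`: there is `s` with `2 ≤ s ≤ K + 2`
  and `‖u² − 1‖ = 2^{−(s+1)}` (so `ord₂ log₂ q = s`, the "depth" of the Tate unit; `k_q = s − 2`).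

References: K. Iwasawa, *Lectures on p-adic L-functions* (1972), §4.4 (the logarithm); J.-P. Serre, *A Course in
Arithmetic*, II §3; R. Greenberg, LNM 1716 (1999), §3 pp. 92–93; cell memo HOME/mult/NOTE-SP1ONE.md §5.
-/

set_option autoImplicit false
-- the Theorems namespace of this sub repeats the summit name by design (D-0017 nested layout: Summit.<S>.<Sub>)
set_option linter.dupNamespace false

noncomputable section

open scoped Classical

namespace Summit.BirchSwinnertonDyer.BirchSwinnertonDyer.Theorems.MultTowerSplitOrder

open PadicInt Literature.NumberTheory.EllipticCurves
  Summit.BirchSwinnertonDyer.BirchSwinnertonDyer.Theorems.MultTowerNS2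

/-! ### Norm computations in `ℤ₂` -/

/-- `‖2‖ < 1` in `ℤ₂`. [folklore] -/
theorem norm_two_lt_one : ‖(2 : ℤ_[2])‖ < 1 := by
  rw [norm_two_padicInt]; norm_num

/-- For `‖z − 1‖ < 1` in `ℤ₂` one has `‖z + 1‖ < 1` (`z + 1 = (z − 1) + 2`). [folklore] -/
theorem norm_add_one_lt_one {z : ℤ_[2]} (hz : ‖z - 1‖ < 1) : ‖z + 1‖ < 1 := by
  have h : z + 1 = (z - 1) + 2 := by ring
  rw [h]
  exact lt_of_le_of_lt (PadicInt.nonarchimedean _ _) (max_lt hz norm_two_lt_one)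

/-- **`‖z^a − 1‖ = ‖z − 1‖` for `a` odd and `‖z − 1‖ < 1`** (in `ℤ₂`): `z^{a+2} − 1 = z²(z^a − 1) + (z² − 1)` and
`‖z² − 1‖ = ‖z − 1‖‖z + 1‖ < ‖z − 1‖`. [folklore] -/
theorem norm_pow_sub_one_of_odd {z : ℤ_[2]} (hz : ‖z - 1‖ < 1) {a : ℕ} (ha : Odd a) :
    ‖z ^ a - 1‖ = ‖z - 1‖ := by
  by_cases hz1 : z = 1
  · subst hz1; simp
  have hz0 : 0 < ‖z - 1‖ := norm_pos_iff.mpr (sub_ne_zero.mpr hz1)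
  have hzn : ‖z‖ = 1 := by
    have h : z = (z - 1) + 1 := by ring
    rw [h, PadicInt.norm_add_eq_max_of_ne (by rw [norm_one]; exact ne_of_lt hz), norm_one, max_eq_right hz.le]
  have hsq : ‖z ^ 2 - 1‖ < ‖z - 1‖ := by
    have hfac : z ^ 2 - 1 = (z - 1) * (z + 1) := by ring
    rw [hfac, norm_mul]
    exact mul_lt_of_lt_one_right hz0 (norm_add_one_lt_one hz)
  obtain ⟨j, rfl⟩ := ha
  induction j with
  | zero => simp
  | succ j ih =>
    have hrec : z ^ (2 * (j + 1) + 1) - 1 = z ^ 2 * (z ^ (2 * j + 1) - 1) + (z ^ 2 - 1) := by ring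
    have h1 : ‖z ^ 2 * (z ^ (2 * j + 1) - 1)‖ = ‖z - 1‖ := by rw [norm_mul, norm_pow, hzn, one_pow, one_mul, ih]
    rw [hrec, PadicInt.norm_add_eq_max_of_ne (by rw [h1]; exact (ne_of_lt hsq).symm), h1, max_eq_left hsq.le]

/-- **`‖y^{2^j} − 1‖ = ‖y − 1‖ · ‖2‖^j` for `‖y − 1‖ < ‖2‖`** (in `ℤ₂`; each squaring multiplies the distance to `1`
by `‖2‖`, tower-1's `norm_sq_sub_one_of_norm_sub_one_lt`). [folklore] -/
theorem norm_pow_two_pow_sub_one {y : ℤ_[2]} (hy : ‖y - 1‖ < ‖(2 : ℤ_[2])‖) (j : ℕ) :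
    ‖y ^ 2 ^ j - 1‖ = ‖y - 1‖ * ‖(2 : ℤ_[2])‖ ^ j := by
  induction j with
  | zero => simp
  | succ j ih =>
    have hlt : ‖y ^ 2 ^ j - 1‖ < ‖(2 : ℤ_[2])‖ := by
      rw [ih]
      calc ‖y - 1‖ * ‖(2 : ℤ_[2])‖ ^ j ≤ ‖y - 1‖ * 1 :=
            mul_le_mul_of_nonneg_left (pow_le_one₀ (norm_nonneg _) norm_two_lt_one.le) (norm_nonneg _)
        _ < ‖(2 : ℤ_[2])‖ := by rw [mul_one]; exact hy
    rw [pow_succ, pow_mul, norm_sq_sub_one_of_norm_sub_one_lt hlt, ih, pow_succ]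
    ring

/-- **`‖(y)^{2^j a} − 1‖ = ‖y − 1‖ · ‖2‖^j`** for `‖y − 1‖ < ‖2‖` and `a` odd. [folklore] -/
theorem norm_pow_two_pow_mul_sub_one {y : ℤ_[2]} (hy : ‖y - 1‖ < ‖(2 : ℤ_[2])‖) (j : ℕ) {a : ℕ} (ha : Odd a) :
    ‖y ^ (2 ^ j * a) - 1‖ = ‖y - 1‖ * ‖(2 : ℤ_[2])‖ ^ j := by
  have hya : ‖y ^ a - 1‖ = ‖y - 1‖ := norm_pow_sub_one_of_odd (hy.trans norm_two_lt_one) ha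
  rw [mul_comm, pow_mul, norm_pow_two_pow_sub_one (by rw [hya]; exact hy), hya]

/-- **`u^{2^j a} ≢ ±1 (mod 2^{s+j+1})`** for `u ∈ ℤ₂` with `‖u² − 1‖ = 2^{−(s+1)}`, `s ≥ 1`, `a` odd and every `j`.
If `u^e ≡ ε (mod 2^{s+j+1})`, `e = 2^j a`, `ε = ±1`, then `u^{2e} − 1 = (u^e − ε)(u^e + ε)` has norm
`< 2^{−(s+j+1)}`, contradicting `‖(u²)^{2^j a} − 1‖ = ‖u² − 1‖ · 2^{−j}`. DEPTH-`s` form of tower-1's BRICK 12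
(`s = 2` ⇔ `u ≡ ±3 (mod 8)`). [folklore] -/
theorem toZModPow_pow_ne_one_and_ne_neg_one_of_depth {u : ℤ_[2]} {s : ℕ} (hs : 1 ≤ s)
    (hu : ‖u ^ 2 - 1‖ = (2 : ℝ) ^ (-((s : ℤ) + 1))) {a : ℕ} (ha : Odd a) (j : ℕ) :
    toZModPow (s + j + 1) (u ^ (2 ^ j * a)) ≠ 1 ∧ toZModPow (s + j + 1) (u ^ (2 ^ j * a)) ≠ -1 := by
  set e : ℕ := 2 ^ j * a with he
  -- `‖u^{2e} − 1‖ = 2^{−(s+j+1)}`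
  have hy : ‖u ^ 2 - 1‖ < ‖(2 : ℤ_[2])‖ := by
    rw [hu, norm_two_padicInt, ← zpow_neg_one]
    exact zpow_lt_zpow_right₀ (by norm_num) (by omega)
  have hnorm : ‖u ^ (2 * e) - 1‖ = (2 : ℝ) ^ (-((s : ℤ) + j + 1)) := by
    rw [pow_mul, he, norm_pow_two_pow_mul_sub_one hy j ha, hu, norm_two_padicInt, inv_pow, ← zpow_natCast,
      ← zpow_neg, ← zpow_add₀ (by norm_num : (2 : ℝ) ≠ 0)]
    congr 1; ring
  -- if `u^e ≡ ε`, then `‖u^{2e} − 1‖ < 2^{−(s+j+1)}`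
  have key : ∀ ε : ℤ_[2], ε ^ 2 = 1 → toZModPow (s + j + 1) (u ^ e) ≠ toZModPow (s + j + 1) ε := by
    intro ε hε hcong
    rw [toZModPow_eq_iff_norm_sub_le] at hcong
    have hεn : ‖ε‖ = 1 := by
      have h := congrArg (fun z : ℤ_[2] ↦ ‖z‖) hε
      simp only [norm_pow, norm_one] at h
      exact (pow_eq_one_iff_of_nonneg (norm_nonneg ε) two_ne_zero).mp h
    have hplus : ‖u ^ e + ε‖ < 1 := by
      have h : u ^ e + ε = (u ^ e - ε) + 2 * ε := by ring
      rw [h]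
      refine lt_of_le_of_lt (PadicInt.nonarchimedean _ _) (max_lt (lt_of_le_of_lt hcong ?_) ?_)
      · exact zpow_lt_one_of_neg₀ (by norm_num) (by push_cast; omega)
      · rw [norm_mul, hεn, mul_one]; exact norm_two_lt_one
    have hfac : u ^ (2 * e) - 1 = (u ^ e - ε) * (u ^ e + ε) := by
      rw [show u ^ (2 * e) = (u ^ e) ^ 2 by rw [mul_comm, pow_mul]]
      linear_combination hε
    have hlt : ‖u ^ (2 * e) - 1‖ < (2 : ℝ) ^ (-((s : ℤ) + j + 1)) := by
      rw [hfac, norm_mul]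
      have hpos : (0 : ℝ) < (2 : ℝ) ^ (-((s : ℤ) + j + 1)) := zpow_pos (by norm_num) _
      rcases eq_or_lt_of_le (norm_nonneg (u ^ e - ε)) with h0 | h0
      · rw [← h0, zero_mul]; exact hpos
      · calc ‖u ^ e - ε‖ * ‖u ^ e + ε‖ < ‖u ^ e - ε‖ * 1 := mul_lt_mul_of_pos_left hplus h0
          _ ≤ (2 : ℝ) ^ (-((s : ℤ) + j + 1)) := by
            rw [mul_one]; convert hcong using 2; push_cast; ring
    rw [hnorm] at hlt
    exact lt_irrefl _ hlt
  constructor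
  · have h := key 1 (one_pow 2)
    rwa [map_one] at h
  · have h := key (-1) (by ring)
    rwa [map_neg, map_one] at h

/-! ### Units of `ℤ₂`: `u² ≡ 1 (mod 8)` -/

/-- **`‖u² − 1‖ ≤ 2^{−3}` for every unit `u` of `ℤ₂`** (`u² ≡ 1 (mod 8)`). [folklore] -/
theorem norm_units_sq_sub_one_le (u : ℤ_[2]ˣ) : ‖(u : ℤ_[2]) ^ 2 - 1‖ ≤ (2 : ℝ) ^ (-(3 : ℤ)) := by
  have key : ∀ t t' : ZMod (2 ^ 3), t * t' = 1 → t ^ 2 = 1 := by decide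
  have h1 : toZModPow 3 ((u : ℤ_[2]) ^ 2) = toZModPow 3 (1 : ℤ_[2]) := by
    rw [map_pow, map_one]
    exact key _ (toZModPow 3 ((u⁻¹ : ℤ_[2]ˣ) : ℤ_[2])) (by rw [← map_mul, Units.mul_inv, map_one])
  have h := (toZModPow_eq_iff_norm_sub_le 3 _ _).mp h1
  exact_mod_cast h

/-! ### The Iwasawa logarithm of a `2`-adic unit -/

/-- **`log₂(2^k · x) = log₂ x`** (`x ≠ 0`): Iwasawa's normalisation `log₂ 2 = 0` (`padicLog_natCast_self_holds`) and
multiplicativity (`padicLog_mul_holds`). [cite: Iwasawa1972PadicL, §4.4] -/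
theorem padicLog_two_pow_mul (k : ℕ) {x : ℚ_[2]} (hx : x ≠ 0) :
    padicLog 2 ((2 : ℚ_[2]) ^ k * x) = padicLog 2 x := by
  have h2 : padicLog 2 (2 : ℚ_[2]) = 0 := by
    have h := padicLog_natCast_self_holds 2
    unfold padicLog_natCast_self at h
    exact_mod_cast h
  induction k with
  | zero => rw [pow_zero, one_mul]
  | succ k ih =>
    rw [pow_succ, mul_assoc, mul_comm (2 : ℚ_[2]), ← mul_assoc,
      padicLog_mul_holds 2 (mul_ne_zero (pow_ne_zero _ two_ne_zero) hx) two_ne_zero, ih, h2, add_zero]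

/-- **`‖log₂ u‖ = 2 · ‖u² − 1‖` for a unit `u` of `ℤ₂`**: `2 log₂ u = log₂ u² = L(u²)` (the logarithmic series,
`padicLog_eq_padicLogSeries`) and `‖L(y)‖ = ‖1 − y‖` for `‖1 − y‖ < ‖2‖` (the tree's log isometry
`norm_padicLogSeries_eq`; here `‖1 − u²‖ ≤ 1/8`). [cite: Iwasawa1972PadicL, §4.4] -/
theorem norm_padicLog_units_eq (u : ℤ_[2]ˣ) :
    ‖padicLog 2 ((u : ℤ_[2]) : ℚ_[2])‖ = 2 * ‖(u : ℤ_[2]) ^ 2 - 1‖ := by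
  set y : ℚ_[2] := ((u : ℤ_[2]) : ℚ_[2]) ^ 2 with hy
  have hu0 : ((u : ℤ_[2]) : ℚ_[2]) ≠ 0 := by
    intro h; exact u.ne_zero (PadicInt.coe_eq_zero.mp h)
  have hyn : ‖1 - y‖ = ‖(u : ℤ_[2]) ^ 2 - 1‖ := by
    rw [← norm_neg, neg_sub, hy, PadicInt.norm_def, PadicInt.coe_sub, PadicInt.coe_pow, PadicInt.coe_one]
  have h8 : ‖1 - y‖ ≤ (2 : ℝ) ^ (-(3 : ℤ)) := by rw [hyn]; exact norm_units_sq_sub_one_le u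
  have htwo : ‖(2 : ℚ_[2])‖ = (2 : ℝ)⁻¹ := by
    have h : ‖((2 : ℕ) : ℚ_[2])‖ = ((2 : ℕ) : ℝ)⁻¹ := Padic.norm_p
    simpa using h
  have hy2 : ‖1 - y‖ < ‖(2 : ℚ_[2])‖ := by
    rw [htwo]; exact lt_of_le_of_lt h8 (by norm_num)
  have hy1 : ‖1 - y‖ < 1 := hy2.trans (by rw [htwo]; norm_num)
  -- `log y = L(y)`, `‖L(y)‖ = ‖1 − y‖`, `log y = 2 log u`
  have hlogy : padicLog 2 y = padicLogSeries 2 y := padicLog_eq_padicLogSeries hy1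
  have hiso : ‖padicLogSeries 2 y‖ = ‖1 - y‖ := norm_padicLogSeries_eq hy2
  have hmul : padicLog 2 y = 2 * padicLog 2 ((u : ℤ_[2]) : ℚ_[2]) := by
    rw [hy, sq, padicLog_mul_holds 2 hu0 hu0, two_mul]
  have h : ‖(2 : ℚ_[2])‖ * ‖padicLog 2 ((u : ℤ_[2]) : ℚ_[2])‖ = ‖(u : ℤ_[2]) ^ 2 - 1‖ := by
    rw [← norm_mul, ← hmul, hlogy, hiso, hyn]
  rw [htwo] at h
  linarith [h]

/-- **The depth of the Tate unit from the Iwasawa logarithm.** For `q = 2^k · u` (`u` a unit of `ℤ₂`) with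
`log₂ q ≠ 0` and `ord₂(log₂ q) ≤ K + 2`, there is `s` with `2 ≤ s ≤ K + 2` and `‖u² − 1‖ = 2^{−(s+1)}` (indeed
`ord₂ log₂ q = s`: `‖log₂ q‖ = ‖log₂ u‖ = 2‖u² − 1‖`). This converts the certificate `hkq` of the split TOWER doors
(`ord₂(log₂ q_E) ≤ k_q + 2`) into the `2`-adic depth hypothesis of the non-norm lemmas.
[cite: Iwasawa1972PadicL, §4.4] [cite: GreenbergLNM1716, §3, between Prop. 3.6 and Prop. 3.7 (PDF pp. 92–93)] -/
theorem exists_depth_of_padicLog {q : ℚ_[2]} {k : ℕ} {u : ℤ_[2]ˣ}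
    (hq : q = (2 : ℚ_[2]) ^ k * ((u : ℤ_[2]) : ℚ_[2])) (hlog : padicLog 2 q ≠ 0) {K : ℕ}
    (hK : (padicLog 2 q).valuation ≤ (K : ℤ) + 2) :
    ∃ s : ℕ, 2 ≤ s ∧ s ≤ K + 2 ∧ ‖(u : ℤ_[2]) ^ 2 - 1‖ = (2 : ℝ) ^ (-((s : ℤ) + 1)) := by
  have hu0 : ((u : ℤ_[2]) : ℚ_[2]) ≠ 0 := by
    intro h; exact u.ne_zero (PadicInt.coe_eq_zero.mp h)
  have hlogq : padicLog 2 q = padicLog 2 ((u : ℤ_[2]) : ℚ_[2]) := by rw [hq, padicLog_two_pow_mul k hu0]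
  have hnorm := norm_padicLog_units_eq u
  rw [← hlogq] at hnorm
  -- `x = u² − 1 ≠ 0`
  set x : ℤ_[2] := (u : ℤ_[2]) ^ 2 - 1 with hx
  have hx0 : x ≠ 0 := by
    intro h0
    rw [h0, norm_zero, mul_zero, norm_eq_zero] at hnorm
    exact hlog hnorm
  -- `‖x‖ = 2^{−v}` with `v ≥ 3`
  have hxv : ‖x‖ = (2 : ℝ) ^ (-(x.valuation : ℤ)) := by
    have h := PadicInt.norm_eq_zpow_neg_valuation hx0
    exact_mod_cast h
  have h3 : 3 ≤ x.valuation := by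
    have hle : ‖x‖ ≤ (2 : ℝ) ^ (-(3 : ℤ)) := norm_units_sq_sub_one_le u
    rw [hxv] at hle
    have := (zpow_le_zpow_iff_right₀ (by norm_num : (1 : ℝ) < 2)).mp hle
    omega
  -- `‖log q‖ = 2^{−(v − 1)}`, so `ord₂ log q = v − 1`
  have hlq : ‖padicLog 2 q‖ = (2 : ℝ) ^ (-((x.valuation : ℤ) - 1)) := by
    rw [hnorm, hxv, show -((x.valuation : ℤ) - 1) = 1 + -(x.valuation : ℤ) by ring,
      zpow_add₀ (by norm_num : (2 : ℝ) ≠ 0), zpow_one]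
  have hval : (padicLog 2 q).valuation = (x.valuation : ℤ) - 1 := by
    have h := Padic.norm_eq_zpow_neg_valuation hlog
    rw [hlq] at h
    have h' : -((x.valuation : ℤ) - 1) = -(padicLog 2 q).valuation :=
      zpow_right_injective₀ (by norm_num : (0 : ℝ) < 2) (by norm_num : (2 : ℝ) ≠ 1) (by exact_mod_cast h)
    omega
  refine ⟨x.valuation - 1, by omega, ?_, ?_⟩
  · have : (padicLog 2 q).valuation ≤ (K : ℤ) + 2 := hK
    rw [hval] at this
    omega
  · rw [hxv]
    congr 1
    omega

end Summit.BirchSwinnertonDyer.BirchSwinnertonDyer.Theorems.MultTowerSplitOrder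

end
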